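import Literature.NumberTheory.EllipticCurves.X049TwistFamily
import Literature.NumberTheory.EllipticCurves.X049GroupOrderUpToSign
import HarnessLib

/-!
# The supersingular primes of the `j = −3375` class, unconditionally: `a_p(W) = 0` for every elliptic `W/ℚ` with `j(W) = −3375`
# and every prime `p ≡ 3, 5, 6 (mod 7)`; and `a_p(E'_d)² = u²` at the ordinary primes `4p = u² + 7v²`

Topic `Literature/NumberTheory/EllipticCurves`, namespace `Literature.NumberTheory.EllipticCurves.X049` (sequel to `X049TwistFamily`,
`X049GroupOrderUpToSign`).  THEOREMS ONLY, all UNCONDITIONAL (no named fact is used).  Deuring's criterion for the CM class `j = −3375`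
(CM by `ℤ[½(1+√−7)]`): a good prime `p` is supersingular iff `p` is inert in `ℚ(√−7)`, i.e. `p ≡ 3, 5, 6 (mod 7)` — here in the concrete form
Rajwade printed it («`N_p = p + 1` if `p ≡ 3, 5, 13 (mod 14)`», Thm. 3, for the whole family `y² = x(x² + 21Dx + 112D²)`):

* `exists_squarefree_LFunction_eq_of_j_eq_neg3375` — every elliptic `W/ℚ` with `j(W) = −3375` has the `L`-function of some `E'_d = [0, 21d, 0, 112d², 0]`,
  `d` square-free (Silverman X.5.4 + `LFunction_smul`);
* ★ `lFunction_apply_prime_eq_zero_cm28Codomain`, ★★ `lFunction_apply_prime_eq_zero_of_j_eq_neg3375` — **`a_p = 0` at every prime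
  `p ≡ 3, 5, 6 (mod 7)`**, for every `E'_d` (`d` square-free) and for every elliptic `W/ℚ` with `j(W) = −3375` (from `X049.lFunction_apply_prime_of_inert`,
  the isogeny `E ∼ E^{(−7)}` argument, through the twist law `a_n(E'_d) = χ_d(n) a_n(49a1)`);
* ★ `lFunction_apply_prime_sq_cm28Codomain` — **`a_p(E'_d)² = u²` whenever `4p = u² + 7v²`, `p ∤ 14d`** (the ordinary primes; Deuring's
  `a_p = π + π̄` up to sign, `X049.numPointsMod_eq_or`, and `(d/p)² = 1`).

Nothing about BSD is proved here.

## References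
* A. R. Rajwade, J. Austral. Math. Soc. A 24 (1977), Thm. 3. [Rajwade1977]
* M. Deuring, *Die Typen der Multiplikatorenringe elliptischer Funktionenkörper* (1941); Cox, *Primes of the form x² + ny²*, Thm. 14.16. [Cox2013]
* J. H. Silverman, *AEC* (2009), X.5 Cor. 5.4.1. [SilvermanAEC2009]
-/

noncomputable section

open scoped Classical NumberTheorySymbols

namespace Literature.NumberTheory.EllipticCurves

namespace X049

open _root_.WeierstrassCurve Literature.NumberTheory.Automorphic Literature.NumberTheory.QuadraticFields

/-- **Every elliptic `W/ℚ` with `j(W) = −3375` has the `L`-function of some `E'_d`, `d` square-free**: `C • W = E'^{(d)}` for `E' = [0, 84, 0, 1792, 0]`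
(Silverman X.5 Cor. 5.4.1) and `E'_d = ⟨2, 0, 0, 0⟩ • E'^{(d)}`; `L` is an isomorphism invariant. [cite: SilvermanAEC2009, X.5 Cor. 5.4.1 and App. C §16] -/
theorem exists_squarefree_LFunction_eq_of_j_eq_neg3375 (W : WeierstrassCurve ℚ) [W.IsElliptic] (hj : W.j = -3375) :
    ∃ d : ℤ, d ≠ 0 ∧ Squarefree d ∧ W.LFunction = ((cm28Codomain d).map (Int.castRingHom ℚ)).LFunction := by
  haveI hE' : (⟨0, 84, 0, 1792, 0⟩ : WeierstrassCurve ℚ).IsElliptic := (isElliptic_mk_twoTorsion_iff 84 1792).mpr (by norm_num)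
  have hjE : (⟨0, 84, 0, 1792, 0⟩ : WeierstrassCurve ℚ).j = -3375 := j_cm28'
  obtain ⟨d, hd, hsq, C, hC⟩ := exists_variableChange_eq_quadraticTwist_intCast_of_j_eq (W := W) (E := ⟨0, 84, 0, 1792, 0⟩)
    (by rw [hj, hjE]) (by rw [hjE]; norm_num) (by rw [hjE]; norm_num)
  haveI : ((⟨0, 84, 0, 1792, 0⟩ : WeierstrassCurve ℚ).quadraticTwist (d : ℚ)).IsElliptic :=
    isElliptic_quadraticTwist _ (Int.cast_ne_zero.mpr hd)
  refine ⟨d, hd, hsq, ?_⟩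
  rw [map_cm28Codomain_eq_smul_quadraticTwist d, LFunction_smul, ← hC, LFunction_smul]

/-- ★ **`a_p(E'_d) = 0` at every prime `p ≡ 3, 5, 6 (mod 7)`**, `d` square-free, UNCONDITIONALLY (Rajwade's «`N_p = p + 1` if `p` is not a norm»
for the whole family): `a_p(E'_d) = χ_d(p)·a_p(49a1)` and `a_p(49a1) = 0` (`X049.lFunction_apply_prime_of_inert`). [cite: Rajwade1977, Thm 3] -/
theorem lFunction_apply_prime_eq_zero_cm28Codomain {d : ℤ} (hsq : Squarefree d) {p : ℕ} (hp : p.Prime)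
    (hp7 : p % 7 = 3 ∨ p % 7 = 5 ∨ p % 7 = 6) : ((cm28Codomain d).map (Int.castRingHom ℚ)).LFunction p = 0 := by
  by_cases hd4 : d % 4 = 1
  · rw [lFunction_twist_of_one_mod_four hsq hd4 p, lFunction_apply_prime_of_inert hp hp7, mul_zero]
  · rw [lFunction_twist_of_not_one_mod_four hsq hd4 p, lFunction_apply_prime_of_inert hp hp7, mul_zero]

/-- ★★ **The supersingular primes of the `j = −3375` class: `a_p(W) = 0` for every elliptic curve `W/ℚ` with `j(W) = −3375` and every prime
`p ≡ 3, 5, 6 (mod 7)`** (the primes inert in the CM field `ℚ(√−7)`), UNCONDITIONALLY — Deuring's criterion for this class with an elementary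
kernel proof (`E ∼_ℚ E^{(−7)}` and Knapp's `L(E) = L(E')`). [cite: Rajwade1977, Thm 3] [cite: Cox2013, Thm. 14.16] -/
theorem lFunction_apply_prime_eq_zero_of_j_eq_neg3375 (W : WeierstrassCurve ℚ) [W.IsElliptic] (hj : W.j = -3375) {p : ℕ} (hp : p.Prime)
    (hp7 : p % 7 = 3 ∨ p % 7 = 5 ∨ p % 7 = 6) : W.LFunction p = 0 := by
  obtain ⟨d, -, hsq, hL⟩ := exists_squarefree_LFunction_eq_of_j_eq_neg3375 W hj
  rw [hL]
  exact lFunction_apply_prime_eq_zero_cm28Codomain hsq hp hp7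

/-- ★ **`a_p(E'_d)² = u²` whenever `4p = u² + 7v²`, `p ∤ 14d`** (`d` square-free), UNCONDITIONALLY: `a_p(E'_d) = (d/p)·a_p(49a1)`, `(d/p)² = 1`,
and `a_p(49a1) = ±u` (`numPointsMod_eq_or`, Deuring).  Only the sign — the group order formula `groupOrder_A7` — is left to print.
[cite: Rajwade1977, Thm 3] [cite: Cox2013, Thm. 14.16] -/
theorem lFunction_apply_prime_sq_cm28Codomain {d : ℤ} {p : ℕ} (hp : p.Prime) (hp2 : p ≠ 2) (hpd : ¬ (p : ℤ) ∣ 7 * d) {u v : ℤ}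
    (huv : u ^ 2 + 7 * v ^ 2 = 4 * p) : ((cm28Codomain d).map (Int.castRingHom ℚ)).LFunction p ^ 2 = u ^ 2 := by
  haveI := Fact.mk hp
  have hp7 : p ≠ 7 := by rintro rfl; exact hpd ⟨d, by ring⟩
  have hpd' : ¬ (p : ℤ) ∣ d := fun h ↦ hpd (dvd_mul_of_dvd_right h 7)
  have hε : J(d | p) ^ 2 = 1 := by
    rw [← jacobiSym.legendreSym.to_jacobiSym]
    exact legendreSym.sq_one p (fun h ↦ hpd' ((ZMod.intCast_zmod_eq_zero_iff_dvd d p).mp h))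
  have ha : (E.map (Int.castRingHom ℚ)).LFunction p ^ 2 = u ^ 2 := by
    rw [lFunction_apply_prime hp hp7]
    rcases numPointsMod_eq_or hp hp7 huv with h | h
    · have : frobeniusTrace E p = u := by unfold Automorphic.frobeniusTrace; linarith
      rw [this]
    · have : frobeniusTrace E p = -u := by unfold Automorphic.frobeniusTrace; linarith
      rw [this]; ring
  rw [lFunction_apply_prime_twist hp hp2 hpd, mul_pow, hε, one_mul, ha]

end X049

end Literature.NumberTheory.EllipticCurves

end
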